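import Summits.CriticalPhenomena.PercolationContinuityZ3.Theorems.Transplant.FKConnectivityAllQPat3LevelsC
import Summits.CriticalPhenomena.PercolationContinuityZ3.Theorems.Transplant.FKConnectivityAllQAntipodalMinorUpc
import HarnessLib

/-!
# Connectivity correlation inequalities for `φ_{w,q}`, every `q > 0` — two-level functionals on MINORS (contracted set riding along) (DEFINITION)

Definitions file (`--supports stmt-CriticalPhenomena-4575`), census lineage (gen 37) of LANE 2's FK sub-programme; builds on
p205010 (kernel theorem, internal audit signed; external expert review pending).  No named facts, no sorries, nothing probabilistic.

The weighted two-level / four-level evaluations of `…Pat3TwoLevelDefs.lean` (`FK.mval2`, `FK.lval4`) for the MINOR "free set `E`,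
contracted set `C`" in fk-2's quotient-free style (`FK.apExpC`, `…AntipodalMinorDefs.lean`; census g36's `FK.lev2C` /
`FK.tvalC`, `…Pat3LevelsC.lean`): the contracted set is open in BOTH members of the antipodal pair, deleted edges are simply absent:
`FK.mval2C w E C x y s F = Σ_{γ ⊆ E} w(k(γ∪C)+k((E∖γ)∪C))·F 0 (pat (γ∪C), pat ((E∖γ)∪C)) + w(…+1)·F 1 (…)`, `FK.lval4C` likewise
with four levels.  Basic facts: `C = ∅` recovers `mval2`/`lval4`; the involution `γ ↦ E ∖ γ` (fk-2's `FK.apExpC_compl`; `FK.mval2C_flip`,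
`FK.lval4C_flip`); levelwise ↔ weighted (`FK.lev2C_cast`, `FK.lev2C_nonneg_of_mval2C`); linearity and domination after
symmetrisation (`FK.lval4C_dom`).  Used by `…Pat3MinorFunctionals.lean` / `…Pat3MinorInduction.lean` (THEOREMS 𝒯₁/𝒯₂ on every
minor of a two-terminal series–parallel 3-mark piece — census g37's question Q-minor).
[cite: Grimmett2006, §1.4 eq. (1.20) (p. 15); §3.8 (pp. 61–62)] [cite: AyyerLinussonRavichandran2025, §7 (p. 22)]
-/

namespace Summit.CriticalPhenomena.PercolationContinuityZ3.Theorems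

namespace FK

open SimpleGraph Literature.Probability.LatticeModels Literature.Probability.Percolation
open scoped Classical

variable {V : Type*}

section MinorEval

variable (w : ℕ → ℝ) (E C : Finset (Sym2 V)) (x y s : V)

/-- **Weighted two-level evaluation on the minor `(E, C)`** (free set `E`, contracted set `C` open in both members of the pair):
`mval2C w E C x y s F = Σ_{γ ⊆ E} w(apExpC E C γ)·F 0 (pat (γ∪C)) (pat ((E∖γ)∪C)) + w(apExpC E C γ + 1)·F 1 (…)`.
[cite: Grimmett2006, §1.4 eq. (1.20) (p. 15)] -/
noncomputable def mval2C (F : ℕ → Pat3 → Pat3 → ℤ) : ℝ :=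
  ∑ γ ∈ E.powerset, (w (apExpC E C γ) * (F 0 (pat3 (γ ∪ C) x y s) (pat3 (E \ γ ∪ C) x y s) : ℝ) +
    w (apExpC E C γ + 1) * (F 1 (pat3 (γ ∪ C) x y s) (pat3 (E \ γ ∪ C) x y s) : ℝ))

/-- **Weighted four-level evaluation on the minor `(E, C)`** (levels `c = 0, 1, 2, 3`). [cite: Grimmett2006, §1.4 eq. (1.20) (p. 15)] -/
noncomputable def lval4C (G : ℕ → Pat3 → Pat3 → ℤ) : ℝ :=
  ∑ γ ∈ E.powerset, ∑ c ∈ Finset.range 4, w (apExpC E C γ + c) * (G c (pat3 (γ ∪ C) x y s) (pat3 (E \ γ ∪ C) x y s) : ℝ)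

end MinorEval

section Basic

variable {w : ℕ → ℝ} {E C : Finset (Sym2 V)} {x y s : V}

/-- With nothing contracted `mval2C` is `mval2`. [folklore] -/
theorem mval2C_empty (w : ℕ → ℝ) (E : Finset (Sym2 V)) (x y s : V) (F : ℕ → Pat3 → Pat3 → ℤ) :
    mval2C w E ∅ x y s F = mval2 w E x y s F := by
  unfold mval2C mval2
  refine Finset.sum_congr rfl fun γ _ => ?_
  rw [apExpC_empty, Finset.union_empty, Finset.union_empty]

/-- With nothing contracted `lval4C` is `lval4`. [folklore] -/
theorem lval4C_empty (w : ℕ → ℝ) (E : Finset (Sym2 V)) (x y s : V) (G : ℕ → Pat3 → Pat3 → ℤ) :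
    lval4C w E ∅ x y s G = lval4 w E x y s G := by
  unfold lval4C lval4
  refine Finset.sum_congr rfl fun γ _ => ?_
  rw [apExpC_empty, Finset.union_empty, Finset.union_empty]

/-- `lval4C` is invariant under transposing the table (the involution `γ ↦ E ∖ γ`). [folklore] -/
theorem lval4C_flip (G : ℕ → Pat3 → Pat3 → ℤ) : lval4C w E C x y s G = lval4C w E C x y s (fun c P Q => G c Q P) := by
  unfold lval4C
  rw [sum_powerset_flip E (fun γ => ∑ c ∈ Finset.range 4,
    w (apExpC E C γ + c) * ((fun c P Q => G c Q P) c (pat3 (γ ∪ C) x y s) (pat3 (E \ γ ∪ C) x y s) : ℝ))]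
  refine Finset.sum_congr rfl fun γ hγ => ?_
  have hγE := Finset.mem_powerset.1 hγ
  simp only [Finset.sdiff_sdiff_eq_self hγE, apExpC_compl hγE]

/-- `mval2C` is invariant under transposing both levels of the member. [folklore] -/
theorem mval2C_flip (F : ℕ → Pat3 → Pat3 → ℤ) : mval2C w E C x y s F = mval2C w E C x y s (fun c P Q => F c Q P) := by
  unfold mval2C
  rw [sum_powerset_flip E (fun γ => w (apExpC E C γ) * ((fun c P Q => F c Q P) 0 (pat3 (γ ∪ C) x y s)
    (pat3 (E \ γ ∪ C) x y s) : ℝ) + w (apExpC E C γ + 1) * ((fun c P Q => F c Q P) 1 (pat3 (γ ∪ C) x y s)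
    (pat3 (E \ γ ∪ C) x y s) : ℝ))]
  refine Finset.sum_congr rfl fun γ hγ => ?_
  have hγE := Finset.mem_powerset.1 hγ
  simp only [Finset.sdiff_sdiff_eq_self hγE, apExpC_compl hγE]

/-- A four-level table with nonnegative coefficients evaluates nonnegatively on a minor against nonnegative weights. [folklore] -/
theorem lval4C_nonneg_of_coef {G : ℕ → Pat3 → Pat3 → ℤ} (hG : ∀ c < 4, ∀ P Q, 0 ≤ G c P Q) (hw : ∀ n, 0 ≤ w n) :
    0 ≤ lval4C w E C x y s G := by
  unfold lval4C
  refine Finset.sum_nonneg fun γ _ => Finset.sum_nonneg fun c hc => mul_nonneg (hw _) ?_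
  exact_mod_cast hG c (Finset.mem_range.1 hc) _ _

/-- The zero member evaluates to zero on every minor. [folklore] -/
theorem mval2C_zero : mval2C w E C x y s (fun _ _ _ => 0) = 0 := by
  unfold mval2C
  simp

/-- Linearity of `lval4C`: sums. [folklore] -/
theorem lval4C_add (G H : ℕ → Pat3 → Pat3 → ℤ) :
    lval4C w E C x y s (fun c P Q => G c P Q + H c P Q) = lval4C w E C x y s G + lval4C w E C x y s H := by
  unfold lval4C
  rw [← Finset.sum_add_distrib]
  refine Finset.sum_congr rfl fun γ _ => ?_
  rw [← Finset.sum_add_distrib]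
  refine Finset.sum_congr rfl fun c _ => ?_
  push_cast
  ring

/-- Linearity of `lval4C`: differences. [folklore] -/
theorem lval4C_sub (G H : ℕ → Pat3 → Pat3 → ℤ) :
    lval4C w E C x y s (fun c P Q => G c P Q - H c P Q) = lval4C w E C x y s G - lval4C w E C x y s H := by
  unfold lval4C
  rw [← Finset.sum_sub_distrib]
  refine Finset.sum_congr rfl fun γ _ => ?_
  rw [← Finset.sum_sub_distrib]
  refine Finset.sum_congr rfl fun c _ => ?_
  push_cast
  ring

/-- Linearity of `lval4C`: integer multiples. [folklore] -/
theorem lval4C_smul (m : ℤ) (G : ℕ → Pat3 → Pat3 → ℤ) :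
    lval4C w E C x y s (fun c P Q => m * G c P Q) = m * lval4C w E C x y s G := by
  unfold lval4C
  rw [Finset.mul_sum]
  refine Finset.sum_congr rfl fun γ _ => ?_
  rw [Finset.mul_sum]
  refine Finset.sum_congr rfl fun c _ => ?_
  push_cast
  ring

/-- A two-level member placed `k ≤ 2` levels up evaluates, on a minor, as the member against the shifted weights. [folklore] -/
theorem lval4C_shift2 {k : ℕ} (hk : k + 1 < 4) (F : ℕ → Pat3 → Pat3 → ℤ) :
    lval4C w E C x y s (shift2 F k) = mval2C (fun n => w (n + k)) E C x y s F := by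
  unfold lval4C mval2C shift2
  refine Finset.sum_congr rfl fun γ _ => ?_
  have hk0 : k ∈ Finset.range 4 := Finset.mem_range.2 (by omega)
  have hk1 : k + 1 ∈ Finset.range 4 := Finset.mem_range.2 hk
  simp only [Int.cast_add, mul_add, Finset.sum_add_distrib]
  congr 1
  · rw [Finset.sum_eq_single_of_mem k hk0]
    · simp
    · intro c _ hc
      simp [hc]
  · rw [Finset.sum_eq_single_of_mem (k + 1) hk1]
    · have e1 : apExpC E C γ + 1 + k = apExpC E C γ + (k + 1) := by omega
      simp [e1]
    · intro c _ hc
      simp [hc]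

/-- **Domination after symmetrisation on a minor**: if `2·(F + Fᵀ) ≥ m · (shift2 G k + (shift2 G k)ᵀ)` coefficientwise, then
`m · mval2C (w shifted by k) G ≤ 2 · lval4C w F` for nonnegative weights. [folklore] -/
theorem lval4C_dom {F G : ℕ → Pat3 → Pat3 → ℤ} {m k : ℕ} (hk : k + 1 < 4)
    (hdom : ∀ c < 4, ∀ P Q, (m : ℤ) * (shift2 G k c P Q + shift2 G k c Q P) ≤ 2 * (F c P Q + F c Q P))
    (hw : ∀ n, 0 ≤ w n) : (m : ℝ) * mval2C (fun n => w (n + k)) E C x y s G ≤ 2 * lval4C w E C x y s F := by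
  have h1 : mval2C (fun n => w (n + k)) E C x y s G = lval4C w E C x y s (shift2 G k) := (lval4C_shift2 hk G).symm
  have h2 : lval4C w E C x y s (shift2 G k) = lval4C w E C x y s (fun c P Q => shift2 G k c Q P) := lval4C_flip _
  have h3 : lval4C w E C x y s F = lval4C w E C x y s (fun c P Q => F c Q P) := lval4C_flip F
  have key : 0 ≤ lval4C w E C x y s
      (fun c P Q => 2 * (F c P Q + F c Q P) - (m : ℤ) * (shift2 G k c P Q + shift2 G k c Q P)) := by
    refine lval4C_nonneg_of_coef (fun c hc P Q => ?_) hw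
    have := hdom c hc P Q
    linarith
  rw [lval4C_sub, lval4C_smul, lval4C_add, lval4C_smul, lval4C_add, ← h2, ← h3] at key
  push_cast at key
  rw [h1]
  nlinarith

/-- The levelwise value on a minor is the weighted evaluation against the indicator weight of the level. [folklore] -/
theorem lev2C_cast (E C : Finset (Sym2 V)) (x y s : V) (F : ℕ → Pat3 → Pat3 → ℤ) (μ : ℕ) :
    (lev2C E C x y s F μ : ℝ) = mval2C (fun n => if n = μ then (1 : ℝ) else 0) E C x y s F := by
  unfold lev2C mval2C
  push_cast
  refine Finset.sum_congr rfl fun γ _ => ?_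
  by_cases h0 : apExpC E C γ = μ <;> by_cases h1 : apExpC E C γ + 1 = μ <;> simp [h0, h1]

/-- A member nonnegative on a minor for all nonnegative weights is nonnegative there at every level. [folklore] -/
theorem lev2C_nonneg_of_mval2C {E C : Finset (Sym2 V)} {x y s : V} {F : ℕ → Pat3 → Pat3 → ℤ}
    (h : ∀ w : ℕ → ℝ, (∀ n, 0 ≤ w n) → 0 ≤ mval2C w E C x y s F) (μ : ℕ) : 0 ≤ lev2C E C x y s F μ := by
  have := h (fun n => if n = μ then (1 : ℝ) else 0) (fun n => by split_ifs <;> norm_num)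
  rw [← lev2C_cast] at this
  exact_mod_cast this

end Basic

end FK

end Summit.CriticalPhenomena.PercolationContinuityZ3.Theorems
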